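import Summits.AtomisticToContinuum.HydrodynamicLimit.Theorems.CollisionIsometryCLTMacroClosureStubClausiusCore
import HarnessLib

/-!
# Sub-goal `engine_readout` of the lead's `stub_engine_pointwise` (line `IdeatorTwoGen1Sketch`, crux
# `MacroClosure`, stmt-AtomisticToContinuum-14870), part A: deterministic helpers of the coercive readout

Support file (`--supports stmt-AtomisticToContinuum-14870`): the deterministic and measure-theoretic
lemmas behind the readout `E_N[𝟙_{G_N} ∫ₓ h_σ(Ū_N | U_cl)] → 0 ⟹ TendstoHydroFieldsAt` (main file
`CollisionIsometryCLTMacroClosureEngineReadout.lean`), all in the helper namespace `Barycentric.EngineReadout`: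

* MOLLIFIER COMMUTATORS for a merely continuous weight `χ` (uniform continuity instead of a gradient
  bound, cf. `stub_balance_B4`): `‖Σ χ(pᵢ) gᵢ − ∫ₓ χ(x) Σ φ(pᵢ − x) gᵢ‖ ≤ ε₁ Σ‖gᵢ‖` whenever
  `|χ y − χ x| ≤ ε₁` on minimal-image balls of the kernel radius; specialised to the empirical density,
  momentum and energy fields against `∫ χ ρ̄`, `∫ χ m̄`, `∫ χ Ē` (`density_comm`, `momentum_comm`,
  `energy_comm`), with `⟨emp, ‖v‖⟩ ≤ 1/2 + e(w)` (`avg_norm_le`);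
* the DETERMINISTIC COERCIVE READOUT (`coercive_readout`): on a band configuration (`c₁ ≤ ρ̄ ≤ σ⁻³`)
  with pairwise distinct velocities and a kernel bounded below `(N+1)c₁`, every block is strictly
  physical, `x ↦ h_σ(Ū(x) | U(x))` is continuous and non-negative (clause-2 coercivity at the values of a
  continuous state field `U`, `f_ex` continuous on the band packings), and
  `∫ₓ ‖Ū − U‖ ≤ κ/2 + (1 + 2/κ) m⁻¹ ∫ₓ h_σ(Ū | U)` (from `d ≤ κ/2 + (1 + 2/κ) min(d², d)`);
* FIELD DEVIATIONS `|∫ χ ρ̄ − ∫ χ U.ρ|, ‖∫ χ m̄ − ∫ χ U.m‖, |∫ χ Ē − ∫ χ U.E| ≤ ‖χ‖_∞ ∫ₓ ‖Ū − U‖` and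
  `e(w) ≤ ∫ₓ ‖Ū − U‖ + ∫ₓ U.E`;
* the MARKOV ASSEMBLY (`tendsto_measure_of_markov`): `P_N(G_Nᶜ) → 0`, `f_N ≥ 0` a.s., `∫ f_N → 0` and
  `f_N ≥ κ'` a.s. on `E_N ∩ G_N` (eventually) give `P_N(E_N) → 0`.
-/

noncomputable section

open MeasureTheory Filter Set Topology InformationTheory
open scoped ENNReal ContDiff

namespace Summit.AtomisticToContinuum.HydrodynamicLimit.Theorems.MacroClosureLine

open Literature.MathematicalPhysics.KineticTheory Literature.Analysis.FluidPDE
open Literature.Analysis.FunctionSpaces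

namespace Barycentric

namespace EngineReadout

variable {N : ℕ}

/-! ## Mollifier commutators for a merely continuous weight -/

/-- **Generic mollifier commutator.** For a continuous kernel `φ ≥ 0` of mass one supported in the
minimal-image ball of radius `r`, a continuous weight `χ` with `|χ y − χ x| ≤ ε₁` whenever
`euclidDist y x < r`, points `pᵢ` and vector weights `gᵢ`:
`‖Σ χ(pᵢ) gᵢ − ∫ₓ χ(x) Σ φ(pᵢ − x) gᵢ‖ ≤ ε₁ Σ ‖gᵢ‖`. -/
theorem norm_sum_smul_sub_integral_le {E : Type*} [NormedAddCommGroup E] [NormedSpace ℝ E]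
    [CompleteSpace E] {φ χ : T3 → ℝ} {r ε₁ : ℝ} (hφc : Continuous φ) (hφ0 : ∀ y, 0 ≤ φ y)
    (hφ1 : ∫ y, φ y = 1) (hsupp : ∀ y, r ≤ Torus.euclidDist y 0 → φ y = 0) (hχc : Continuous χ)
    (hmod : ∀ x y, Torus.euclidDist y x < r → |χ y - χ x| ≤ ε₁) {n : ℕ} (p : Fin n → T3)
    (g : Fin n → E) :
    ‖(∑ i, χ (p i) • g i) - ∫ x, χ x • ∑ i, φ (p i - x) • g i‖ ≤ ε₁ * ∑ i, ‖g i‖ := by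
  have hint : ∀ i, Integrable (fun x => (χ x * φ (p i - x)) • g i) := fun i =>
    (integrable_of_continuous_T3 (hχc.mul (hφc.comp (continuous_const.sub continuous_id)))).smul_const _
  have hswap : (fun x => χ x • ∑ i, φ (p i - x) • g i) = fun x => ∑ i, (χ x * φ (p i - x)) • g i := by
    funext x
    rw [Finset.smul_sum]
    exact Finset.sum_congr rfl fun i _ => by rw [smul_smul]
  rw [hswap, integral_finsetSum _ fun i _ => hint i]
  simp_rw [integral_smul_const]
  rw [← Finset.sum_sub_distrib]
  calc ‖∑ i, (χ (p i) • g i - (∫ x, χ x * φ (p i - x)) • g i)‖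
      ≤ ∑ i, ‖χ (p i) • g i - (∫ x, χ x * φ (p i - x)) • g i‖ := norm_sum_le _ _
    _ ≤ ∑ i, ε₁ * ‖g i‖ := Finset.sum_le_sum fun i _ => by
        rw [← sub_smul, norm_smul, Real.norm_eq_abs, abs_sub_comm]
        exact mul_le_mul_of_nonneg_right
          (MesoLLN.abs_integral_mul_translate_sub_le hφc hφ0 hφ1 hsupp hχc hmod (p i)) (norm_nonneg _)
    _ = ε₁ * ∑ i, ‖g i‖ := by rw [Finset.mul_sum]

section Comm

variable {φ χ : T3 → ℝ} {r ε₁ : ℝ} (hφc : Continuous φ) (hφ0 : ∀ y, 0 ≤ φ y)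
  (hφ1 : ∫ y, φ y = 1) (hsupp : ∀ y, r ≤ Torus.euclidDist y 0 → φ y = 0) (hχc : Continuous χ)
  (hmod : ∀ x y, Torus.euclidDist y x < r → |χ y - χ x| ≤ ε₁)
include hφc hφ0 hφ1 hsupp hχc hmod

/-- Density commutator: `|⟨emp w, χ⟩ − ∫ₓ χ ρ̄| ≤ ε₁`. -/
theorem density_comm (w : Config (N + 1) (Fin 3) T3) :
    |empiricalDensityField w χ - ∫ x, χ x * bρ φ w x| ≤ ε₁ := by
  have hN : ((N + 1 : ℕ) : ℝ) ≠ 0 := by positivity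
  have h := norm_sum_smul_sub_integral_le hφc hφ0 hφ1 hsupp hχc hmod (fun i => (w i).1)
    (fun _ => ((N + 1 : ℕ) : ℝ)⁻¹)
  have h1 : empiricalDensityField w χ = ∑ i, χ (w i).1 • ((N + 1 : ℕ) : ℝ)⁻¹ := by
    rw [empiricalDensityField_eq_sum, Finset.mul_sum]
    exact Finset.sum_congr rfl fun i _ => by rw [smul_eq_mul, mul_comm]
  have h2 : (fun x => χ x * bρ φ w x) =
      fun x => χ x • ∑ i, φ ((w i).1 - x) • ((N + 1 : ℕ) : ℝ)⁻¹ := by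
    funext x
    rw [bρ_eq_sum, Finset.mul_sum, smul_eq_mul]
    congr 1
    exact Finset.sum_congr rfl fun i _ => by rw [smul_eq_mul, mul_comm]
  have h3 : ε₁ * ∑ _i : Fin (N + 1), ‖((N + 1 : ℕ) : ℝ)⁻¹‖ = ε₁ := by
    rw [Finset.sum_const, Finset.card_univ, Fintype.card_fin, nsmul_eq_mul, Real.norm_eq_abs,
      abs_of_nonneg (inv_nonneg.2 (Nat.cast_nonneg _)), mul_inv_cancel₀ hN, mul_one]
  rw [← Real.norm_eq_abs, h1, h2]
  exact h.trans_eq h3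

/-- Momentum commutator: `‖⟨emp w, χ v⟩ − ∫ₓ χ m̄‖ ≤ ε₁ ⟨emp w, ‖v‖⟩`. -/
theorem momentum_comm (w : Config (N + 1) (Fin 3) T3) :
    ‖empiricalMomentumField w χ - ∫ x, χ x • bm φ w x‖ ≤
      ε₁ * (((N + 1 : ℕ) : ℝ)⁻¹ * ∑ i, ‖(w i).2‖) := by
  have hN0 : (0 : ℝ) ≤ ((N + 1 : ℕ) : ℝ)⁻¹ := inv_nonneg.2 (Nat.cast_nonneg _)
  have h := norm_sum_smul_sub_integral_le (E := V3) hφc hφ0 hφ1 hsupp hχc hmod (fun i => (w i).1)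
    (fun i => ((N + 1 : ℕ) : ℝ)⁻¹ • (w i).2)
  have h1 : empiricalMomentumField w χ = ∑ i, χ (w i).1 • (((N + 1 : ℕ) : ℝ)⁻¹ • (w i).2) := by
    rw [empiricalMomentumField_eq_sum, Finset.smul_sum]
    exact Finset.sum_congr rfl fun i _ => by rw [smul_comm]
  have h2 : (fun x => χ x • bm φ w x) =
      fun x => χ x • ∑ i, φ ((w i).1 - x) • (((N + 1 : ℕ) : ℝ)⁻¹ • (w i).2) := by
    funext x
    have hb : bm φ w x = ((N + 1 : ℕ) : ℝ)⁻¹ • ∑ i, φ ((w i).1 - x) • (w i).2 := by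
      simp only [bm, empiricalMomentumField]
      rw [integral_empiricalMeasure_V3]
    rw [hb, Finset.smul_sum]
    congr 1
    exact Finset.sum_congr rfl fun i _ => by rw [smul_comm]
  have h3 : ∑ i, ‖((N + 1 : ℕ) : ℝ)⁻¹ • (w i).2‖ = ((N + 1 : ℕ) : ℝ)⁻¹ * ∑ i, ‖(w i).2‖ := by
    rw [Finset.mul_sum]
    exact Finset.sum_congr rfl fun i _ => by rw [norm_smul, Real.norm_eq_abs, abs_of_nonneg hN0]
  rw [h1, h2, ← h3]
  exact h

/-- Energy commutator: `|⟨emp w, χ |v|²/2⟩ − ∫ₓ χ Ē| ≤ ε₁ e(w)`. -/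
theorem energy_comm (w : Config (N + 1) (Fin 3) T3) :
    |empiricalEnergyField w χ - ∫ x, χ x * bE φ w x| ≤
      ε₁ * empiricalEnergyField w (fun _ => (1 : ℝ)) := by
  have h := norm_sum_smul_sub_integral_le hφc hφ0 hφ1 hsupp hχc hmod (fun i => (w i).1)
    (fun i => ((N + 1 : ℕ) : ℝ)⁻¹ * (‖(w i).2‖ ^ 2 / 2))
  have h1 : empiricalEnergyField w χ = ∑ i, χ (w i).1 • (((N + 1 : ℕ) : ℝ)⁻¹ * (‖(w i).2‖ ^ 2 / 2)) := by
    rw [empiricalEnergyField_eq_sum, Finset.mul_sum]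
    exact Finset.sum_congr rfl fun i _ => by rw [smul_eq_mul]; ring
  have h2 : (fun x => χ x * bE φ w x) =
      fun x => χ x • ∑ i, φ ((w i).1 - x) • (((N + 1 : ℕ) : ℝ)⁻¹ * (‖(w i).2‖ ^ 2 / 2)) := by
    funext x
    rw [bE_eq_sum, Finset.mul_sum, smul_eq_mul]
    congr 1
    exact Finset.sum_congr rfl fun i _ => by rw [smul_eq_mul]; ring
  have h3 : ∑ i, ‖((N + 1 : ℕ) : ℝ)⁻¹ * (‖(w i).2‖ ^ 2 / 2)‖ = empiricalEnergyField w (fun _ => (1 : ℝ)) := by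
    rw [Clausius.empiricalEnergyField_one, Finset.mul_sum]
    exact Finset.sum_congr rfl fun i _ => by
      rw [Real.norm_eq_abs, abs_of_nonneg (by positivity)]
  rw [← Real.norm_eq_abs, h1, h2, ← h3]
  exact h

end Comm

/-- `⟨emp w, ‖v‖⟩ ≤ 1/2 + e(w)` (termwise `‖v‖ ≤ (1 + ‖v‖²)/2`). -/
theorem avg_norm_le (w : Config (N + 1) (Fin 3) T3) :
    ((N + 1 : ℕ) : ℝ)⁻¹ * ∑ i, ‖(w i).2‖ ≤ 1 / 2 + empiricalEnergyField w (fun _ => (1 : ℝ)) := by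
  have hN : (0 : ℝ) < ((N + 1 : ℕ) : ℝ) := by positivity
  rw [Clausius.empiricalEnergyField_one]
  have hterm : ∀ i : Fin (N + 1), ‖(w i).2‖ ≤ 1 / 2 + ‖(w i).2‖ ^ 2 / 2 := fun i => by
    nlinarith [sq_nonneg (‖(w i).2‖ - 1), norm_nonneg (w i).2]
  calc ((N + 1 : ℕ) : ℝ)⁻¹ * ∑ i, ‖(w i).2‖
      ≤ ((N + 1 : ℕ) : ℝ)⁻¹ * ∑ i : Fin (N + 1), (1 / 2 + ‖(w i).2‖ ^ 2 / 2) :=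
        mul_le_mul_of_nonneg_left (Finset.sum_le_sum fun i _ => hterm i) (inv_nonneg.2 hN.le)
    _ = 1 / 2 + ((N + 1 : ℕ) : ℝ)⁻¹ * ∑ i, ‖(w i).2‖ ^ 2 / 2 := by
        rw [Finset.sum_add_distrib, Finset.sum_const, Finset.card_univ, Fintype.card_fin,
          nsmul_eq_mul, mul_add, ← mul_assoc, inv_mul_cancel₀ hN.ne', one_mul]

/-! ## The deterministic coercive readout on a band configuration -/

/-- Elementary: `d ≤ κ/2 + (1 + 2/κ) min(d², d)` for `d ≥ 0`, `κ > 0`. -/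
theorem le_half_add_min {κ d : ℝ} (hκ : 0 < κ) (hd : 0 ≤ d) :
    d ≤ κ / 2 + (1 + 2 / κ) * min (d ^ 2) d := by
  have hmin0 : 0 ≤ min (d ^ 2) d := le_min (sq_nonneg _) hd
  have hc : 0 ≤ 1 + 2 / κ := by positivity
  rcases le_or_gt d (κ / 2) with h | h
  · nlinarith [mul_nonneg hc hmin0]
  · rcases le_or_gt 1 d with h1 | h1
    · rw [min_eq_right (by nlinarith : d ≤ d ^ 2)]
      have : 0 ≤ 2 / κ * d := by positivity
      nlinarith
    · rw [min_eq_left (by nlinarith : d ^ 2 ≤ d)]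
      have hd0 : 0 < d := lt_of_le_of_lt (by positivity) h
      have hk : d ≤ 2 / κ * d ^ 2 := by
        rw [div_mul_eq_mul_div, le_div_iff₀ hκ]
        nlinarith [mul_le_mul_of_nonneg_left (show κ ≤ 2 * d by linarith) hd0.le]
      nlinarith [sq_nonneg d]

section Core

variable {σ c₁ m Φb : ℝ} {φ : T3 → ℝ} {U : T3 → State} {w : Config (N + 1) (Fin 3) T3}

/-- On the band, with a kernel bounded below `(N+1)c₁` and pairwise distinct velocities, every block
is strictly physical: `‖m̄‖² < 2ρ̄Ē` and `θ̄ > 0`. -/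
theorem strict_of_band (hφ0 : ∀ y, 0 ≤ φ y) (hφb : ∀ y, φ y ≤ Φb)
    (hNb : Φb < ((N + 1 : ℕ) : ℝ) * c₁) (hband : ∀ x, c₁ ≤ bρ φ w x ∧ bρ φ w x * σ ^ 3 ≤ 1)
    (hvel : ∀ i j : Fin (N + 1), i ≠ j → (w i).2 ≠ (w j).2) (x : T3) :
    ‖bm φ w x‖ ^ 2 < 2 * bρ φ w x * bE φ w x ∧ 0 < stateTemp (bU φ w x) := by
  obtain ⟨a, b, hab, ha, hb⟩ := Clausius.exists_two_weights hφ0 hφb hNb w x (hband x).1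
  exact ⟨Clausius.norm_bm_sq_lt hφ0 w x ha hb (hvel a b hab),
    Clausius.stateTemp_bU_pos hφ0 w x ha hb (hvel a b hab)⟩

/-- **Deterministic coercive readout.** For a band configuration with pairwise distinct velocities,
a continuous classical state field `U` with `η_σ ∘ U`, `Dη_σ ∘ U` continuous and the coercivity of
clause 2 of `ThermoChamber` at every `U x`: the relative entropy density `x ↦ h_σ(Ū(x) | U(x))` is
continuous and non-negative, and `∫ₓ ‖Ū − U‖ ≤ κ/2 + (1 + 2/κ) m⁻¹ ∫ₓ h_σ(Ū | U)` for every `κ > 0`. -/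
theorem coercive_readout (hσ : 0 < σ) (hc₁ : 0 < c₁) (hm : 0 < m)
    (hfex : ContinuousOn hsExcessFreeEnergy (Icc (c₁ * σ ^ 3) 1)) (hφc : Continuous φ)
    (hφ0 : ∀ y, 0 ≤ φ y) (hφb : ∀ y, φ y ≤ Φb) (hNb : Φb < ((N + 1 : ℕ) : ℝ) * c₁)
    (hUc : Continuous U) (hηU : Continuous fun x => hsEntropy σ (U x))
    (hΛU : Continuous fun x => fderiv ℝ (hsEntropy σ) (U x))
    (hcoer : ∀ x, ∀ V : State, 0 < V.1 → V.1 * σ ^ 3 < 11 / 10 → ‖V.2.1‖ ^ 2 < 2 * V.1 * V.2.2 →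
      m * min (‖V - U x‖ ^ 2) ‖V - U x‖ ≤ relEnt σ V (U x))
    (hband : ∀ x, c₁ ≤ bρ φ w x ∧ bρ φ w x * σ ^ 3 ≤ 1)
    (hvel : ∀ i j : Fin (N + 1), i ≠ j → (w i).2 ≠ (w j).2) {κ : ℝ} (hκ : 0 < κ) :
    Continuous (fun x => relEnt σ (bU φ w x) (U x)) ∧
    (∀ x, 0 ≤ relEnt σ (bU φ w x) (U x)) ∧
    ∫ x, ‖bU φ w x - U x‖ ≤ κ / 2 + (1 + 2 / κ) / m * ∫ x, relEnt σ (bU φ w x) (U x) := by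
  have hst := fun x => strict_of_band hφ0 hφb hNb hband hvel x
  have hcontη : Continuous fun x => hsEntropy σ (bU φ w x) :=
    Clausius.continuous_hsEntropy_bU hσ hc₁ hfex hφc w hband fun x => (hst x).2
  have hbU : Continuous fun x => bU φ w x :=
    (Clausius.continuous_bρ hφc w).prodMk ((Clausius.continuous_bm hφc w).prodMk
      (Clausius.continuous_bE hφc w))
  have hrel : Continuous fun x => relEnt σ (bU φ w x) (U x) := by
    unfold relEnt
    exact (hcontη.sub hηU).sub (hΛU.clm_apply (hbU.sub hUc))
  have hpt : ∀ x, m * min (‖bU φ w x - U x‖ ^ 2) ‖bU φ w x - U x‖ ≤ relEnt σ (bU φ w x) (U x) :=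
    fun x => hcoer x (bU φ w x) (hc₁.trans_le (hband x).1) ((hband x).2.trans_lt (by norm_num)) (hst x).1
  have hmin0 : ∀ x, 0 ≤ min (‖bU φ w x - U x‖ ^ 2) ‖bU φ w x - U x‖ := fun x =>
    le_min (sq_nonneg _) (norm_nonneg _)
  have h0 : ∀ x, 0 ≤ relEnt σ (bU φ w x) (U x) := fun x => (mul_nonneg hm.le (hmin0 x)).trans (hpt x)
  refine ⟨hrel, h0, ?_⟩
  have hcκ : 0 ≤ 1 + 2 / κ := by positivity
  have hptd : ∀ x, ‖bU φ w x - U x‖ ≤ κ / 2 + (1 + 2 / κ) / m * relEnt σ (bU φ w x) (U x) := by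
    intro x
    have h1 := le_half_add_min hκ (norm_nonneg (bU φ w x - U x))
    have h2 : (1 + 2 / κ) * min (‖bU φ w x - U x‖ ^ 2) ‖bU φ w x - U x‖ ≤
        (1 + 2 / κ) / m * relEnt σ (bU φ w x) (U x) := by
      rw [div_mul_eq_mul_div, le_div_iff₀ hm]
      calc (1 + 2 / κ) * min (‖bU φ w x - U x‖ ^ 2) ‖bU φ w x - U x‖ * m
          = (1 + 2 / κ) * (m * min (‖bU φ w x - U x‖ ^ 2) ‖bU φ w x - U x‖) := by ring
        _ ≤ (1 + 2 / κ) * relEnt σ (bU φ w x) (U x) := mul_le_mul_of_nonneg_left (hpt x) hcκ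
    linarith
  have hi1 : Integrable (fun x => ‖bU φ w x - U x‖) := integrable_of_continuous_T3 (hbU.sub hUc).norm
  have hi3 : Integrable (fun x => (1 + 2 / κ) / m * relEnt σ (bU φ w x) (U x)) :=
    (integrable_of_continuous_T3 hrel).const_mul _
  have hi2 : Integrable (fun x => κ / 2 + (1 + 2 / κ) / m * relEnt σ (bU φ w x) (U x)) :=
    (integrable_const _).add hi3
  calc ∫ x, ‖bU φ w x - U x‖ ≤ ∫ x, (κ / 2 + (1 + 2 / κ) / m * relEnt σ (bU φ w x) (U x)) :=
        integral_mono hi1 hi2 hptd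
    _ = κ / 2 + (1 + 2 / κ) / m * ∫ x, relEnt σ (bU φ w x) (U x) := by
        rw [integral_add (integrable_const _) hi3, integral_const, probReal_univ, one_smul,
          integral_const_mul]

/-! ## Field deviations against the classical state -/

variable {χ : T3 → ℝ} {Cχ : ℝ}

/-- `|∫ χ ρ̄ − ∫ χ U.ρ| ≤ ‖χ‖_∞ ∫ₓ ‖Ū − U‖`. -/
theorem density_dev (hχc : Continuous χ) (hχb : ∀ x, |χ x| ≤ Cχ) (hφc : Continuous φ)
    (hUc : Continuous U) (w : Config (N + 1) (Fin 3) T3) :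
    |(∫ x, χ x * bρ φ w x) - ∫ x, χ x * (U x).1| ≤ Cχ * ∫ x, ‖bU φ w x - U x‖ := by
  have hbU : Continuous fun x => bU φ w x :=
    (Clausius.continuous_bρ hφc w).prodMk ((Clausius.continuous_bm hφc w).prodMk
      (Clausius.continuous_bE hφc w))
  have hi1 : Integrable (fun x => χ x * bρ φ w x) :=
    integrable_of_continuous_T3 (hχc.mul (Clausius.continuous_bρ hφc w))
  have hi2 : Integrable (fun x => χ x * (U x).1) := integrable_of_continuous_T3 (hχc.mul hUc.fst)
  have hi3 : Integrable (fun x => ‖bU φ w x - U x‖) := integrable_of_continuous_T3 (hbU.sub hUc).norm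
  rw [← integral_sub hi1 hi2, ← Real.norm_eq_abs]
  calc ‖∫ x, (χ x * bρ φ w x - χ x * (U x).1)‖ ≤ ∫ x, ‖χ x * bρ φ w x - χ x * (U x).1‖ :=
        norm_integral_le_integral_norm _
    _ ≤ ∫ x, Cχ * ‖bU φ w x - U x‖ := by
        refine integral_mono (hi1.sub hi2).norm (hi3.const_mul _) fun x => ?_
        dsimp only
        rw [← mul_sub, norm_mul, Real.norm_eq_abs]
        exact mul_le_mul (hχb x) (norm_fst_le (bU φ w x - U x)) (norm_nonneg _)
          ((abs_nonneg _).trans (hχb x))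
    _ = Cχ * ∫ x, ‖bU φ w x - U x‖ := integral_const_mul _ _

/-- `‖∫ χ m̄ − ∫ χ U.m‖ ≤ ‖χ‖_∞ ∫ₓ ‖Ū − U‖`. -/
theorem momentum_dev (hχc : Continuous χ) (hχb : ∀ x, |χ x| ≤ Cχ) (hφc : Continuous φ)
    (hUc : Continuous U) (w : Config (N + 1) (Fin 3) T3) :
    ‖(∫ x, χ x • bm φ w x) - ∫ x, χ x • (U x).2.1‖ ≤ Cχ * ∫ x, ‖bU φ w x - U x‖ := by
  have hbU : Continuous fun x => bU φ w x :=
    (Clausius.continuous_bρ hφc w).prodMk ((Clausius.continuous_bm hφc w).prodMk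
      (Clausius.continuous_bE hφc w))
  have hi1 : Integrable (fun x => χ x • bm φ w x) :=
    integrable_of_continuous_T3 (hχc.smul (Clausius.continuous_bm hφc w))
  have hi2 : Integrable (fun x => χ x • (U x).2.1) := integrable_of_continuous_T3 (hχc.smul hUc.snd.fst)
  have hi3 : Integrable (fun x => ‖bU φ w x - U x‖) := integrable_of_continuous_T3 (hbU.sub hUc).norm
  rw [← integral_sub hi1 hi2]
  calc ‖∫ x, (χ x • bm φ w x - χ x • (U x).2.1)‖ ≤ ∫ x, ‖χ x • bm φ w x - χ x • (U x).2.1‖ :=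
        norm_integral_le_integral_norm _
    _ ≤ ∫ x, Cχ * ‖bU φ w x - U x‖ := by
        refine integral_mono (hi1.sub hi2).norm (hi3.const_mul _) fun x => ?_
        dsimp only
        rw [← smul_sub, norm_smul, Real.norm_eq_abs]
        exact mul_le_mul (hχb x) ((norm_fst_le (bU φ w x - U x).2).trans (norm_snd_le (bU φ w x - U x)))
          (norm_nonneg _) ((abs_nonneg _).trans (hχb x))
    _ = Cχ * ∫ x, ‖bU φ w x - U x‖ := integral_const_mul _ _

/-- `|∫ χ Ē − ∫ χ U.E| ≤ ‖χ‖_∞ ∫ₓ ‖Ū − U‖`. -/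
theorem energy_dev (hχc : Continuous χ) (hχb : ∀ x, |χ x| ≤ Cχ) (hφc : Continuous φ)
    (hUc : Continuous U) (w : Config (N + 1) (Fin 3) T3) :
    |(∫ x, χ x * bE φ w x) - ∫ x, χ x * (U x).2.2| ≤ Cχ * ∫ x, ‖bU φ w x - U x‖ := by
  have hbU : Continuous fun x => bU φ w x :=
    (Clausius.continuous_bρ hφc w).prodMk ((Clausius.continuous_bm hφc w).prodMk
      (Clausius.continuous_bE hφc w))
  have hi1 : Integrable (fun x => χ x * bE φ w x) :=
    integrable_of_continuous_T3 (hχc.mul (Clausius.continuous_bE hφc w))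
  have hi2 : Integrable (fun x => χ x * (U x).2.2) := integrable_of_continuous_T3 (hχc.mul hUc.snd.snd)
  have hi3 : Integrable (fun x => ‖bU φ w x - U x‖) := integrable_of_continuous_T3 (hbU.sub hUc).norm
  rw [← integral_sub hi1 hi2, ← Real.norm_eq_abs]
  calc ‖∫ x, (χ x * bE φ w x - χ x * (U x).2.2)‖ ≤ ∫ x, ‖χ x * bE φ w x - χ x * (U x).2.2‖ :=
        norm_integral_le_integral_norm _
    _ ≤ ∫ x, Cχ * ‖bU φ w x - U x‖ := by
        refine integral_mono (hi1.sub hi2).norm (hi3.const_mul _) fun x => ?_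
        dsimp only
        rw [← mul_sub, norm_mul, Real.norm_eq_abs]
        exact mul_le_mul (hχb x) ((norm_snd_le (bU φ w x - U x).2).trans (norm_snd_le (bU φ w x - U x)))
          (norm_nonneg _) ((abs_nonneg _).trans (hχb x))
    _ = Cχ * ∫ x, ‖bU φ w x - U x‖ := integral_const_mul _ _

/-- The kinetic energy per particle is controlled by the `L¹` distance to the classical state:
`e(w) = ∫ₓ Ē ≤ ∫ₓ ‖Ū − U‖ + ∫ₓ U.E`. -/
theorem energy_le (hφc : Continuous φ) (hφ1 : ∫ y, φ y = 1) (hUc : Continuous U)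
    (w : Config (N + 1) (Fin 3) T3) :
    empiricalEnergyField w (fun _ => (1 : ℝ)) ≤ (∫ x, ‖bU φ w x - U x‖) + ∫ x, (U x).2.2 := by
  have hbU : Continuous fun x => bU φ w x :=
    (Clausius.continuous_bρ hφc w).prodMk ((Clausius.continuous_bm hφc w).prodMk
      (Clausius.continuous_bE hφc w))
  have hi3 : Integrable (fun x => ‖bU φ w x - U x‖) := integrable_of_continuous_T3 (hbU.sub hUc).norm
  have hi4 : Integrable (fun x => (U x).2.2) := integrable_of_continuous_T3 hUc.snd.snd
  rw [← Clausius.integral_bE hφc hφ1 w, ← integral_add hi3 hi4]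
  refine integral_mono (integrable_of_continuous_T3 (Clausius.continuous_bE hφc w)) (hi3.add hi4)
    fun x => ?_
  have h := (norm_snd_le (bU φ w x - U x).2).trans (norm_snd_le (bU φ w x - U x))
  have h' : bE φ w x - (U x).2.2 ≤ ‖bU φ w x - U x‖ := by
    have h2 : |(bU φ w x - U x).2.2| ≤ ‖bU φ w x - U x‖ := by
      rw [← Real.norm_eq_abs]; exact h
    exact (le_abs_self _).trans h2
  dsimp only
  linarith

end Core

/-! ## Markov assembly -/

/-- **Markov assembly.** If `P_N(G_Nᶜ) → 0`, `f_N ≥ 0` a.s. (eventually), `∫ f_N dP_N → 0`, and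
eventually a.s. every point of `E_N ∩ G_N` has `f_N ≥ κ' > 0`, then `P_N(E_N) → 0`. -/
theorem tendsto_measure_of_markov {Ω : ℕ → Type*} [∀ N, MeasurableSpace (Ω N)]
    (P : (N : ℕ) → Measure (Ω N)) [∀ N, IsFiniteMeasure (P N)] (G E : (N : ℕ) → Set (Ω N))
    (f : (N : ℕ) → Ω N → ℝ) {κ' : ℝ} (hκ' : 0 < κ')
    (hGc : Tendsto (fun N => P N (G N)ᶜ) atTop (𝓝 0)) (hfi : ∀ N, Integrable (f N) (P N))
    (hlim : Tendsto (fun N => ∫ z, f N z ∂P N) atTop (𝓝 0))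
    (hf0 : ∀ᶠ N in atTop, 0 ≤ᵐ[P N] f N)
    (hEv : ∀ᶠ N in atTop, ∀ᵐ z ∂P N, z ∈ E N → z ∈ G N → κ' ≤ f N z) :
    Tendsto (fun N => P N (E N)) atTop (𝓝 0) := by
  have hup : Tendsto (fun N => P N (G N)ᶜ + ENNReal.ofReal ((∫ z, f N z ∂P N) / κ')) atTop (𝓝 0) := by
    have h2 : Tendsto (fun N => ENNReal.ofReal ((∫ z, f N z ∂P N) / κ')) atTop (𝓝 0) := by
      have h := ENNReal.tendsto_ofReal (hlim.div_const κ')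
      rwa [zero_div, ENNReal.ofReal_zero] at h
    simpa using hGc.add h2
  refine tendsto_of_tendsto_of_tendsto_of_le_of_le' tendsto_const_nhds hup
    (Eventually.of_forall fun N => zero_le) ?_
  filter_upwards [hf0, hEv] with N hN0 hN
  have hM := mul_meas_ge_le_integral_of_nonneg hN0 (hfi N) κ'
  have hreal : (P N).real {z | κ' ≤ f N z} ≤ (∫ z, f N z ∂P N) / κ' := by
    rw [le_div_iff₀ hκ', mul_comm]; exact hM
  calc P N (E N) ≤ P N ((G N)ᶜ ∪ {z | κ' ≤ f N z}) := by
        refine measure_mono_ae ?_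
        filter_upwards [hN] with z hz hzE
        by_cases hzG : z ∈ G N
        · exact Or.inr (hz hzE hzG)
        · exact Or.inl hzG
    _ ≤ P N (G N)ᶜ + P N {z | κ' ≤ f N z} := measure_union_le _ _
    _ ≤ P N (G N)ᶜ + ENNReal.ofReal ((∫ z, f N z ∂P N) / κ') := by
        gcongr
        calc P N {z | κ' ≤ f N z} = ENNReal.ofReal ((P N).real {z | κ' ≤ f N z}) :=
              (ENNReal.ofReal_toReal (measure_ne_top _ _)).symm
          _ ≤ _ := ENNReal.ofReal_le_ofReal hreal

end EngineReadout

/-- Registered helper sub-goal `engine_readout_coercive` of `engine_readout`: the deterministic coercive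
readout on a band configuration (`EngineReadout.coercive_readout`) — for a band configuration with pairwise
distinct velocities and a kernel bounded below `(N+1)c₁`, clause-2 coercivity at the values of a continuous
state field `U` (with `η_σ ∘ U`, `Dη_σ ∘ U` continuous, `f_ex` continuous on the band packings) makes
`x ↦ h_σ(Ū(x) | U(x))` continuous and non-negative and gives
`∫ₓ ‖Ū − U‖ ≤ κ/2 + (1 + 2/κ) m⁻¹ ∫ₓ h_σ(Ū | U)`. [folklore] -/
theorem engine_readout_coercive : ∀ {N : ℕ} (σ c₁ m Φb : ℝ) (φ : T3 → ℝ) (U : T3 → State) (w : Config (N + 1) (Fin 3) T3), 0 < σ → 0 < c₁ → 0 < m → ContinuousOn hsExcessFreeEnergy (Icc (c₁ * σ ^ 3) 1) → Continuous φ → (∀ y, 0 ≤ φ y) → (∀ y, φ y ≤ Φb) → Φb < ((N + 1 : ℕ) : ℝ) * c₁ → Continuous U → Continuous (fun x => hsEntropy σ (U x)) → Continuous (fun x => fderiv ℝ (hsEntropy σ) (U x)) → (∀ x, ∀ V : State, 0 < V.1 → V.1 * σ ^ 3 < 11 / 10 → ‖V.2.1‖ ^ 2 < 2 * V.1 * V.2.2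 → m * min (‖V - U x‖ ^ 2) ‖V - U x‖ ≤ relEnt σ V (U x)) → (∀ x, c₁ ≤ bρ φ w x ∧ bρ φ w x * σ ^ 3 ≤ 1) → (∀ i j : Fin (N + 1), i ≠ j → (w i).2 ≠ (w j).2) → ∀ κ : ℝ, 0 < κ → Continuous (fun x => relEnt σ (bU φ w x) (U x)) ∧ (∀ x, 0 ≤ relEnt σ (bU φ w x) (U x)) ∧ ∫ x, ‖bU φ w x - U x‖ ≤ κ / 2 + (1 + 2 / κ) / m * ∫ x, relEnt σ (bU φ w x) (U x) :=
  fun _ _ _ _ _ _ _ hσ hc₁ hm hfex hφc hφ0 hφb hNb hUc hηU hΛU hcoer hband hvel _ hκ =>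
    EngineReadout.coercive_readout hσ hc₁ hm hfex hφc hφ0 hφb hNb hUc hηU hΛU hcoer hband hvel hκ

end Barycentric

end Summit.AtomisticToContinuum.HydrodynamicLimit.Theorems.MacroClosureLine

end
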